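import Summits.CriticalPhenomena.PercolationContinuityZ3.Theorems.PercNearOneGluingNoHeavyQuantSDEC
import HarnessLib

/-!
# QUANT lane R8 on trees: the TENSOR-CERTIFICATE PRINCIPLE for the two-layer closure ("K-SGC") — a pointwise inequality on the grid
# `{0..M₁} × {0..M₂}` between the target kernel and row-reflections, column-reflections and mean tilts proves one two-layer bound of the
# gated product, for ALL laws with those parameters

builds on p205010 (kernel theorem, internal audit signed; external expert review pending)

Support file (`--supports stmt-CriticalPhenomena-4575`), QUANT lane seat prim-quant-arm-2 (gen 38), rung R8 of
`run/shared/lean/prim/quant/LADDER.md`; memo `run/shared/lean/prim/quant/prim-quant-arm-2-g38/TWO-LAYER-CLOSURE-G38.md` §6–§7.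
Theorems only (no definitions), standard axioms, no sorries.  Vocabulary: `LawDec.gate`, `LawDec.lconv` (census-2 g53, `…QuantSDEC`).  The two-layer
family of a law `ν` on `{0..M}` at floor `y`, threshold `t` (`…QuantTwoLayerClosure`, this seat, in review) is written here UNFOLDED:
`∀ j′ ≤ j, j + j′ < t → y·Σ_{h ≤ j′} ν h ≤ (1−y)·Σ_{h ≥ j+1} ν h`.

THE PRINCIPLE.  Fix `0 < y < 1`, `0 < q ≤ 1`, probability laws `μ₁` on `{0..M₁}`, `μ₂` on `{0..M₂}` with means `T₁`, `T₂`, and a pair of layers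
`(i, i′)`.  For the gated law `gate μ q` the two-layer bound at `(j, j′)` reads `E_μ[G_{j,j′}] ≥ 0` with the ROW FUNCTIONAL
`G_{j,j′}(a) = (1−y)q·[j+1 ≤ a] − yq·[a ≤ j′] − y(1−q)` (the phantom zero `1−q` of the gate is the constant), and the bound to prove for
`gate (lconv μ₁ μ₂) q` at `(i, i′)` reads `E_{μ₁⊗μ₂}[K] ≥ 0` with the KERNEL `K(a,s) = (1−y)q·[i+1 ≤ a+s] − yq·[a+s ≤ i′] − y(1−q)`.
**If there are weights `λ j j′ s ≥ 0` (row `s` uses factor 1's bound at `(j,j′)`), `κ j j′ a ≥ 0` (column `a` uses factor 2's bound), supported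
on VALID pairs (`j′ ≤ j`, `j + j′ < qTᵢ`), and free tilts `ρ₁ s`, `ρ₂ a`, such that POINTWISE on the grid**
`Σ λ j j′ s·G¹_{j,j′}(a) + Σ κ j j′ a·G²_{j,j′}(s) + ρ₁ s·(a − T₁) + ρ₂ a·(s − T₂) ≤ K(a,s)`   (`a ≤ M₁`, `s ≤ M₂`),
**then the two-layer bound of the gated product at `(i, i′)` holds** (`twoLayer_pair_of_certificate`): integrate against `μ₁(a)μ₂(s)` — the row
terms are `≥ 0` by factor 1's hypothesis, the column terms by factor 2's, the tilts vanish (means), and the kernel integrates to the bound.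
Independence enters only through the product weights; the same certificate proves the bound for every JOINT law whose row- and column-conditionals
satisfy the factor hypotheses.  EXACT EVIDENCE (memo §6, `code/pwcert.py`): the certificate LP is feasible at every sampled parameter tuple
(≈ 3 500; y down to 1/10, q down to 1/5, M ≤ 7; 0 infeasible); without tilts exactly in the regime q = 1, y ≥ 1/2, where memo §7 gives the explicit
certificate S* (validated pointwise on 187 732 tuples) — its kernel version is the next file.
HONEST STATUS: a proof DEVICE; `TwoLayerConvClosed`, `TreeBuiltFAR`, `FarTreeRow` remain OPEN; the RATE class log\* and the honest sentence of
`run/shared/lean/prim/quant/README.md` are unchanged.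

* `LawDec.sum_fun_mul_lconv` — `Σ_h φ h·lconv μ₁ μ₂ h = Σ_a Σ_s φ(a+s)·μ₁ a·μ₂ s`; `LawDec.sum_fun_mul_gate` — `Σ_h φ h·gate μ q h = qΣ_h φ h·μ h + (1−q)φ 0`.
* `LawDec.twoLayer_pair_iff_functional` — the two-layer bound of `gate μ q` at `(j,j′)` ⟺ `0 ≤ E_μ[G_{j,j′}]` (for a probability law `μ`, `1 ≤ j+1`).
* **`LawDec.twoLayer_pair_of_certificate`** — the principle.

[this work].  Nothing here is cited as a published result.  The gluing rows served [cite: KozmaNitzan2024, Conjecture 3 (p. 15)]; product measure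
[cite: Grimmett1999, §1.3 p. 10].
-/

noncomputable section

namespace Summit.CriticalPhenomena.PercolationContinuityZ3.Theorems

namespace Quant

open Finset

namespace LawDec

/-! ### Bookkeeping: test functions against `lconv` and `gate` -/

/-- **a test function against the convolution**: `Σ_{h ≤ M₁+M₂} φ h·lconv μ₁ μ₂ h = Σ_{a ≤ M₁} Σ_{s ≤ M₂} φ(a+s)·μ₁ a·μ₂ s`. [this work] -/
theorem sum_fun_mul_lconv (M₁ M₂ : ℕ) (μ₁ μ₂ : ℕ → ℝ) (φ : ℕ → ℝ) :
    ∑ h ∈ Finset.range (M₁ + M₂ + 1), φ h * lconv M₁ M₂ μ₁ μ₂ h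
      = ∑ a ∈ Finset.range (M₁ + 1), ∑ s ∈ Finset.range (M₂ + 1), φ (a + s) * (μ₁ a * μ₂ s) := by
  simp only [lconv, Finset.mul_sum]
  rw [Finset.sum_comm]
  refine Finset.sum_congr rfl fun a ha => ?_
  rw [Finset.sum_comm]
  refine Finset.sum_congr rfl fun s hs => ?_
  rw [Finset.mem_range] at ha hs
  have e : ∀ h : ℕ, φ h * (if a + s = h then μ₁ a * μ₂ s else 0) = if a + s = h then φ (a + s) * (μ₁ a * μ₂ s) else 0 := by
    intro h
    split_ifs with hh
    · rw [hh]
    · rw [mul_zero]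
  simp_rw [e]
  rw [Finset.sum_ite_eq (Finset.range (M₁ + M₂ + 1)) (a + s), if_pos (Finset.mem_range.2 (by omega))]

/-- **a test function against a gated law**: `Σ_{h ≤ M} φ h·gate μ q h = q·Σ_{h ≤ M} φ h·μ h + (1−q)·φ 0`. [this work] -/
theorem sum_fun_mul_gate (M : ℕ) (μ : ℕ → ℝ) (q : ℝ) (φ : ℕ → ℝ) :
    ∑ h ∈ Finset.range (M + 1), φ h * gate μ q h = q * ∑ h ∈ Finset.range (M + 1), φ h * μ h + (1 - q) * φ 0 := by
  simp only [gate]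
  have e : ∀ h : ℕ, φ h * (q * μ h + (if h = 0 then 1 - q else 0)) = q * (φ h * μ h) + (if h = 0 then (1 - q) * φ 0 else 0) := by
    intro h
    split_ifs with hh
    · rw [hh]; ring
    · ring
  simp_rw [e]
  rw [Finset.sum_add_distrib, ← Finset.mul_sum, Finset.sum_ite_eq' (Finset.range (M + 1)) 0,
    if_pos (Finset.mem_range.2 (Nat.succ_pos M))]

/-- an `ite`-weighted sum as a test function. [this work] -/
theorem sum_ite_eq_sum_indicator_mul (M : ℕ) (ν : ℕ → ℝ) (P : ℕ → Prop) [DecidablePred P] :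
    ∑ h ∈ Finset.range (M + 1), (if P h then ν h else 0) = ∑ h ∈ Finset.range (M + 1), (if P h then (1 : ℝ) else 0) * ν h :=
  Finset.sum_congr rfl fun h _ => by split_ifs <;> simp

/-! ### The two-layer bound of a gated law as a functional inequality -/

/-- **the two-layer bound of `gate μ q` at `(j, j′)` in functional form**: for a law `μ` on `{0..M}` of mass `1`,
`y·Σ_{h ≤ j′} gate μ q h ≤ (1−y)·Σ_{h ≥ j+1} gate μ q h ⟺ 0 ≤ Σ_h μ h·G_{j,j′}(h)` with
`G_{j,j′}(h) = (1−y)q·[j+1 ≤ h] − yq·[h ≤ j′] − y(1−q)`. [this work] -/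
theorem twoLayer_pair_iff_functional (y q : ℝ) (M j j' : ℕ) (μ : ℕ → ℝ) (hμ1 : ∑ h ∈ Finset.range (M + 1), μ h = 1) :
    (y * ∑ h ∈ Finset.range (M + 1), (if h ≤ j' then gate μ q h else 0)
        ≤ (1 - y) * ∑ h ∈ Finset.range (M + 1), (if j + 1 ≤ h then gate μ q h else 0)) ↔
      0 ≤ ∑ h ∈ Finset.range (M + 1), μ h *
        ((1 - y) * q * (if j + 1 ≤ h then (1 : ℝ) else 0) - y * q * (if h ≤ j' then (1 : ℝ) else 0) - y * (1 - q)) := by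
  rw [sum_ite_eq_sum_indicator_mul M (gate μ q) (fun h => h ≤ j'), sum_ite_eq_sum_indicator_mul M (gate μ q) (fun h => j + 1 ≤ h),
    sum_fun_mul_gate, sum_fun_mul_gate]
  simp only [Nat.zero_le, if_true]
  rw [if_neg (by omega : ¬ (j + 1 ≤ 0))]
  have hsplit : ∑ h ∈ Finset.range (M + 1), μ h *
      ((1 - y) * q * (if j + 1 ≤ h then (1 : ℝ) else 0) - y * q * (if h ≤ j' then (1 : ℝ) else 0) - y * (1 - q))
      = (1 - y) * q * ∑ h ∈ Finset.range (M + 1), (if j + 1 ≤ h then (1 : ℝ) else 0) * μ h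
        - y * q * ∑ h ∈ Finset.range (M + 1), (if h ≤ j' then (1 : ℝ) else 0) * μ h
        - y * (1 - q) * ∑ h ∈ Finset.range (M + 1), μ h := by
    rw [Finset.mul_sum, Finset.mul_sum, Finset.mul_sum, ← Finset.sum_sub_distrib, ← Finset.sum_sub_distrib]
    refine Finset.sum_congr rfl fun h _ => by ring
  rw [hsplit, hμ1]
  constructor
  · intro h; nlinarith [h]
  · intro h; nlinarith [h]

/-! ### The principle -/

/-- **THE TENSOR-CERTIFICATE PRINCIPLE FOR THE TWO-LAYER CLOSURE.**  `0 < y < 1`, `0 < q ≤ 1`; `μ₁`, `μ₂` probability laws on `{0..M₁}`,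
`{0..M₂}` (nonnegative, mass `1`; `T₁`, `T₂` their means); the gated laws satisfy the two-layer family at floor `y`, thresholds `qT₁`, `qT₂`
(hypotheses `hB1`, `hB2`, unfolded); a pair `(i, i′)`.  GIVEN weights `λ κ : ℕ → ℕ → ℕ → ℝ` (nonnegative, supported on valid pairs: `0 < λ j j′ s →
j′ ≤ j ∧ j + j′ < qT₁`, `0 < κ j j′ a → j′ ≤ j ∧ j + j′ < qT₂`) and tilts `ρ₁ ρ₂ : ℕ → ℝ` with the POINTWISE inequality
`Σ_{j,j′ ≤ M₁} λ j j′ s·G¹_{j,j′}(a) + Σ_{j,j′ ≤ M₂} κ j j′ a·G²_{j,j′}(s) + ρ₁ s·(a − T₁) + ρ₂ a·(s − T₂) ≤ K_{i,i′}(a+s)` for all `a ≤ M₁`, `s ≤ M₂`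
(`G` as in `twoLayer_pair_iff_functional`, `K_{i,i′}(n) = (1−y)q·[i+1 ≤ n] − yq·[n ≤ i′] − y(1−q)`), the two-layer bound of
`gate (lconv M₁ M₂ μ₁ μ₂) q` at `(i, i′)` holds. [this work] -/
theorem twoLayer_pair_of_certificate (y q : ℝ) (M₁ M₂ : ℕ) (μ₁ μ₂ : ℕ → ℝ) (i i' : ℕ)
    (h10 : ∀ h, 0 ≤ μ₁ h) (h11 : ∑ h ∈ Finset.range (M₁ + 1), μ₁ h = 1)
    (h20 : ∀ h, 0 ≤ μ₂ h) (h21 : ∑ h ∈ Finset.range (M₂ + 1), μ₂ h = 1)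
    (hB1 : ∀ j j' : ℕ, j' ≤ j → (j : ℝ) + j' < q * ∑ h ∈ Finset.range (M₁ + 1), (h : ℝ) * μ₁ h →
      y * ∑ h ∈ Finset.range (M₁ + 1), (if h ≤ j' then gate μ₁ q h else 0)
        ≤ (1 - y) * ∑ h ∈ Finset.range (M₁ + 1), (if j + 1 ≤ h then gate μ₁ q h else 0))
    (hB2 : ∀ j j' : ℕ, j' ≤ j → (j : ℝ) + j' < q * ∑ h ∈ Finset.range (M₂ + 1), (h : ℝ) * μ₂ h →
      y * ∑ h ∈ Finset.range (M₂ + 1), (if h ≤ j' then gate μ₂ q h else 0)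
        ≤ (1 - y) * ∑ h ∈ Finset.range (M₂ + 1), (if j + 1 ≤ h then gate μ₂ q h else 0))
    (lam kap : ℕ → ℕ → ℕ → ℝ) (ρ₁ ρ₂ : ℕ → ℝ)
    (hlam0 : ∀ j j' s, 0 ≤ lam j j' s)
    (hlamv : ∀ j j' s, 0 < lam j j' s → j' ≤ j ∧ (j : ℝ) + j' < q * ∑ h ∈ Finset.range (M₁ + 1), (h : ℝ) * μ₁ h)
    (hkap0 : ∀ j j' a, 0 ≤ kap j j' a)
    (hkapv : ∀ j j' a, 0 < kap j j' a → j' ≤ j ∧ (j : ℝ) + j' < q * ∑ h ∈ Finset.range (M₂ + 1), (h : ℝ) * μ₂ h)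
    (hcert : ∀ a ∈ Finset.range (M₁ + 1), ∀ s ∈ Finset.range (M₂ + 1),
      (∑ j ∈ Finset.range (M₁ + 1), ∑ j' ∈ Finset.range (M₁ + 1), lam j j' s *
          ((1 - y) * q * (if j + 1 ≤ a then (1 : ℝ) else 0) - y * q * (if a ≤ j' then (1 : ℝ) else 0) - y * (1 - q)))
      + (∑ j ∈ Finset.range (M₂ + 1), ∑ j' ∈ Finset.range (M₂ + 1), kap j j' a *
          ((1 - y) * q * (if j + 1 ≤ s then (1 : ℝ) else 0) - y * q * (if s ≤ j' then (1 : ℝ) else 0) - y * (1 - q)))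
      + ρ₁ s * ((a : ℝ) - ∑ h ∈ Finset.range (M₁ + 1), (h : ℝ) * μ₁ h)
      + ρ₂ a * ((s : ℝ) - ∑ h ∈ Finset.range (M₂ + 1), (h : ℝ) * μ₂ h)
      ≤ (1 - y) * q * (if i + 1 ≤ a + s then (1 : ℝ) else 0) - y * q * (if a + s ≤ i' then (1 : ℝ) else 0) - y * (1 - q)) :
    y * ∑ h ∈ Finset.range (M₁ + M₂ + 1), (if h ≤ i' then gate (lconv M₁ M₂ μ₁ μ₂) q h else 0)
      ≤ (1 - y) * ∑ h ∈ Finset.range (M₁ + M₂ + 1), (if i + 1 ≤ h then gate (lconv M₁ M₂ μ₁ μ₂) q h else 0) := by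
  -- abbreviations
  set T₁ : ℝ := ∑ h ∈ Finset.range (M₁ + 1), (h : ℝ) * μ₁ h with hT₁
  set T₂ : ℝ := ∑ h ∈ Finset.range (M₂ + 1), (h : ℝ) * μ₂ h with hT₂
  set G₁ : ℕ → ℕ → ℕ → ℝ := fun j j' a =>
    (1 - y) * q * (if j + 1 ≤ a then (1 : ℝ) else 0) - y * q * (if a ≤ j' then (1 : ℝ) else 0) - y * (1 - q) with hG₁
  set K : ℕ → ℝ := fun n =>
    (1 - y) * q * (if i + 1 ≤ n then (1 : ℝ) else 0) - y * q * (if n ≤ i' then (1 : ℝ) else 0) - y * (1 - q) with hK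
  -- (1) the goal in functional form: `0 ≤ Σ_a Σ_s μ₁ a μ₂ s · K(a+s)`
  have hmassL : ∑ h ∈ Finset.range (M₁ + M₂ + 1), lconv M₁ M₂ μ₁ μ₂ h = 1 := sum_lconv M₁ M₂ μ₁ μ₂ h11 h21
  rw [twoLayer_pair_iff_functional y q (M₁ + M₂) i i' (lconv M₁ M₂ μ₁ μ₂) hmassL]
  have hgoal : ∑ h ∈ Finset.range (M₁ + M₂ + 1), lconv M₁ M₂ μ₁ μ₂ h * K h
      = ∑ a ∈ Finset.range (M₁ + 1), ∑ s ∈ Finset.range (M₂ + 1), K (a + s) * (μ₁ a * μ₂ s) := by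
    rw [← sum_fun_mul_lconv M₁ M₂ μ₁ μ₂ K]
    exact Finset.sum_congr rfl fun h _ => mul_comm _ _
  show 0 ≤ ∑ h ∈ Finset.range (M₁ + M₂ + 1), lconv M₁ M₂ μ₁ μ₂ h * K h
  rw [hgoal]
  -- (2) the factor hypotheses in functional form
  have hrow : ∀ j j' : ℕ, j' ≤ j → (j : ℝ) + j' < q * T₁ → 0 ≤ ∑ a ∈ Finset.range (M₁ + 1), μ₁ a * G₁ j j' a := by
    intro j j' hjj hjt
    exact (twoLayer_pair_iff_functional y q M₁ j j' μ₁ h11).1 (hB1 j j' hjj hjt)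
  have hcol : ∀ j j' : ℕ, j' ≤ j → (j : ℝ) + j' < q * T₂ → 0 ≤ ∑ s ∈ Finset.range (M₂ + 1), μ₂ s * G₁ j j' s := by
    intro j j' hjj hjt
    exact (twoLayer_pair_iff_functional y q M₂ j j' μ₂ h21).1 (hB2 j j' hjj hjt)
  -- weighted versions: `λ j j′ s · Σ_a μ₁ a G ≥ 0` (valid pair or zero weight)
  have hrow' : ∀ j j' s, 0 ≤ lam j j' s * ∑ a ∈ Finset.range (M₁ + 1), μ₁ a * G₁ j j' a := by
    intro j j' s
    rcases (hlam0 j j' s).lt_or_eq with hpos | hzero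
    · obtain ⟨hjj, hjt⟩ := hlamv j j' s hpos
      exact mul_nonneg hpos.le (hrow j j' hjj hjt)
    · rw [← hzero, zero_mul]
  have hcol' : ∀ j j' a, 0 ≤ kap j j' a * ∑ s ∈ Finset.range (M₂ + 1), μ₂ s * G₁ j j' s := by
    intro j j' a
    rcases (hkap0 j j' a).lt_or_eq with hpos | hzero
    · obtain ⟨hjj, hjt⟩ := hkapv j j' a hpos
      exact mul_nonneg hpos.le (hcol j j' hjj hjt)
    · rw [← hzero, zero_mul]
  -- (3) the tilts vanish: `Σ_a μ₁ a (a − T₁) = 0`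
  have htilt1 : ∑ a ∈ Finset.range (M₁ + 1), μ₁ a * ((a : ℝ) - T₁) = 0 := by
    have : ∑ a ∈ Finset.range (M₁ + 1), μ₁ a * ((a : ℝ) - T₁)
        = ∑ a ∈ Finset.range (M₁ + 1), (a : ℝ) * μ₁ a - T₁ * ∑ a ∈ Finset.range (M₁ + 1), μ₁ a := by
      rw [Finset.mul_sum, ← Finset.sum_sub_distrib]
      exact Finset.sum_congr rfl fun a _ => by ring
    rw [this, h11, mul_one, hT₁, sub_self]
  have htilt2 : ∑ s ∈ Finset.range (M₂ + 1), μ₂ s * ((s : ℝ) - T₂) = 0 := by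
    have : ∑ s ∈ Finset.range (M₂ + 1), μ₂ s * ((s : ℝ) - T₂)
        = ∑ s ∈ Finset.range (M₂ + 1), (s : ℝ) * μ₂ s - T₂ * ∑ s ∈ Finset.range (M₂ + 1), μ₂ s := by
      rw [Finset.mul_sum, ← Finset.sum_sub_distrib]
      exact Finset.sum_congr rfl fun s _ => by ring
    rw [this, h21, mul_one, hT₂, sub_self]
  -- (4) integrate the certificate against `μ₁ a μ₂ s ≥ 0`
  have hint : ∑ a ∈ Finset.range (M₁ + 1), ∑ s ∈ Finset.range (M₂ + 1), (μ₁ a * μ₂ s) *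
      ((∑ j ∈ Finset.range (M₁ + 1), ∑ j' ∈ Finset.range (M₁ + 1), lam j j' s * G₁ j j' a)
        + (∑ j ∈ Finset.range (M₂ + 1), ∑ j' ∈ Finset.range (M₂ + 1), kap j j' a * G₁ j j' s)
        + ρ₁ s * ((a : ℝ) - T₁) + ρ₂ a * ((s : ℝ) - T₂))
      ≤ ∑ a ∈ Finset.range (M₁ + 1), ∑ s ∈ Finset.range (M₂ + 1), K (a + s) * (μ₁ a * μ₂ s) := by
    refine Finset.sum_le_sum fun a ha => Finset.sum_le_sum fun s hs => ?_
    rw [mul_comm (K (a + s))]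
    exact mul_le_mul_of_nonneg_left (hcert a ha s hs) (mul_nonneg (h10 a) (h20 s))
  refine le_trans ?_ hint
  -- (5) split the integrand into its four parts
  have e1 : ∀ a s, (μ₁ a * μ₂ s) *
      ((∑ j ∈ Finset.range (M₁ + 1), ∑ j' ∈ Finset.range (M₁ + 1), lam j j' s * G₁ j j' a)
        + (∑ j ∈ Finset.range (M₂ + 1), ∑ j' ∈ Finset.range (M₂ + 1), kap j j' a * G₁ j j' s)
        + ρ₁ s * ((a : ℝ) - T₁) + ρ₂ a * ((s : ℝ) - T₂))
      = μ₂ s * (μ₁ a * ∑ j ∈ Finset.range (M₁ + 1), ∑ j' ∈ Finset.range (M₁ + 1), lam j j' s * G₁ j j' a)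
        + μ₁ a * (μ₂ s * ∑ j ∈ Finset.range (M₂ + 1), ∑ j' ∈ Finset.range (M₂ + 1), kap j j' a * G₁ j j' s)
        + (μ₂ s * ρ₁ s) * (μ₁ a * ((a : ℝ) - T₁)) + (μ₁ a * ρ₂ a) * (μ₂ s * ((s : ℝ) - T₂)) := by
    intro a s; ring
  simp_rw [e1, Finset.sum_add_distrib]
  -- part 3 and part 4 vanish (tilts)
  have p3 : ∑ a ∈ Finset.range (M₁ + 1), ∑ s ∈ Finset.range (M₂ + 1), (μ₂ s * ρ₁ s) * (μ₁ a * ((a : ℝ) - T₁)) = 0 := by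
    rw [Finset.sum_comm]
    refine Finset.sum_eq_zero fun s _ => ?_
    rw [← Finset.mul_sum, htilt1, mul_zero]
  have p4 : ∑ a ∈ Finset.range (M₁ + 1), ∑ s ∈ Finset.range (M₂ + 1), (μ₁ a * ρ₂ a) * (μ₂ s * ((s : ℝ) - T₂)) = 0 := by
    refine Finset.sum_eq_zero fun a _ => ?_
    rw [← Finset.mul_sum, htilt2, mul_zero]
  -- part 1: row terms
  have p1 : 0 ≤ ∑ a ∈ Finset.range (M₁ + 1), ∑ s ∈ Finset.range (M₂ + 1),
      μ₂ s * (μ₁ a * ∑ j ∈ Finset.range (M₁ + 1), ∑ j' ∈ Finset.range (M₁ + 1), lam j j' s * G₁ j j' a) := by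
    rw [Finset.sum_comm]
    refine Finset.sum_nonneg fun s _ => ?_
    rw [← Finset.mul_sum]
    refine mul_nonneg (h20 s) ?_
    have : ∑ a ∈ Finset.range (M₁ + 1), μ₁ a * ∑ j ∈ Finset.range (M₁ + 1), ∑ j' ∈ Finset.range (M₁ + 1), lam j j' s * G₁ j j' a
        = ∑ j ∈ Finset.range (M₁ + 1), ∑ j' ∈ Finset.range (M₁ + 1), lam j j' s * ∑ a ∈ Finset.range (M₁ + 1), μ₁ a * G₁ j j' a := by
      simp_rw [Finset.mul_sum]
      rw [Finset.sum_comm]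
      refine Finset.sum_congr rfl fun j _ => ?_
      rw [Finset.sum_comm]
      refine Finset.sum_congr rfl fun j' _ => Finset.sum_congr rfl fun a _ => by ring
    rw [this]
    exact Finset.sum_nonneg fun j _ => Finset.sum_nonneg fun j' _ => hrow' j j' s
  -- part 2: column terms
  have p2 : 0 ≤ ∑ a ∈ Finset.range (M₁ + 1), ∑ s ∈ Finset.range (M₂ + 1),
      μ₁ a * (μ₂ s * ∑ j ∈ Finset.range (M₂ + 1), ∑ j' ∈ Finset.range (M₂ + 1), kap j j' a * G₁ j j' s) := by
    refine Finset.sum_nonneg fun a _ => ?_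
    rw [← Finset.mul_sum]
    refine mul_nonneg (h10 a) ?_
    have : ∑ s ∈ Finset.range (M₂ + 1), μ₂ s * ∑ j ∈ Finset.range (M₂ + 1), ∑ j' ∈ Finset.range (M₂ + 1), kap j j' a * G₁ j j' s
        = ∑ j ∈ Finset.range (M₂ + 1), ∑ j' ∈ Finset.range (M₂ + 1), kap j j' a * ∑ s ∈ Finset.range (M₂ + 1), μ₂ s * G₁ j j' s := by
      simp_rw [Finset.mul_sum]
      rw [Finset.sum_comm]
      refine Finset.sum_congr rfl fun j _ => ?_
      rw [Finset.sum_comm]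
      refine Finset.sum_congr rfl fun j' _ => Finset.sum_congr rfl fun s _ => by ring
    rw [this]
    exact Finset.sum_nonneg fun j _ => Finset.sum_nonneg fun j' _ => hcol' j j' a
  rw [p3, p4, add_zero, add_zero]
  exact add_nonneg p1 p2

end LawDec

end Quant

end Summit.CriticalPhenomena.PercolationContinuityZ3.Theorems
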